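import Summits.AtomisticToContinuum.Crystallization.Theorems.PricedLinkCensusLocalToGlobalFccMirrorSmearedField
import Summits.AtomisticToContinuum.Crystallization.Theorems.PricedLinkCensusLocalToGlobalConfinedThomson

/-!
# The smeared Newton field: weighted bounds and the weak Gauss law `div (smearedField r) = ρ`

Route `PricedLinkCensus`, crux `LocalToGlobal` (stmt-AtomisticToContinuum-14232), line
`flux-cell-joint-census`, support for the registered stub `stub_fccMirrorExact : NewtonShell8 → FccMirrorExact`
(`Theorems/PricedLinkCensusLocalToGlobalDefs`), second half (`fluxCell ≤ S₆`, the method of images).  For the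
smeared field and potential of the uniform probability `ρ` on `B(0, r) ⊂ ℝ⁸`
(`PricedLinkCensusLocalToGlobalFccMirrorSmearedField`):

* WEIGHTED BOUNDS `‖smearedField r z‖ ≤ C (1 + ‖z‖)⁻⁷`, `|smearedPotential r z| ≤ C (1 + ‖z‖)⁻⁶` (near: the
  uniform ball bounds of `‖·‖⁻⁷`, `‖·‖⁻⁶`; far: `‖z - w‖ ≥ ‖z‖/2` on the ball);
* THE WEAK GAUSS LAW (registered sub-goal `fccMirror_smearedField_weakDiv`): for every `φ ∈ C¹_c(ℝ⁸)`,

    `∫ ⟪smearedField r z, ∇φ(z)⟫ dz = -⨍_{B(0,r)} φ`,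

  i.e. the smeared field of the unit charge on the ball is an exact Gauss field of that charge on ALL of `ℝ⁸`.
  Proof: for the regularised potentials `v_t = farPotential t ρ`, `∫⟪∇v_t, ∇φ⟫ = -∫ Δv_t φ =
  -∫ ρ(w) (∫ Δf_t(z - w) φ(z) dz) dw` (Green, Fubini); as `t → 0⁺` the left side tends to `-2π⁴ ∫⟪smearedField, ∇φ⟫`
  (uniform convergence of the gradients) and the right side to `2π⁴ ∫ ρ φ` (`Δf_t` is `-2π⁴` times an approximate
  identity, `PricedLinkCensusLocalToGlobalFccMirrorPointField`).

References: D. Gilbarg, N. S. Trudinger, *Elliptic PDE of second order* (2001), Lemma 4.1, (2.17); E. H. Lieb,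
M. Loss, *Analysis* (2001), Thm 6.21, Thm 9.7.
-/

noncomputable section

open MeasureTheory Set Filter Metric Topology InnerProductSpace Function
open scoped RealInnerProductSpace Laplacian

namespace Summit.AtomisticToContinuum.Crystallization.Theorems.PricedLinkCensusLocalToGlobal

variable {r : ℝ}

/-! ### Weighted bounds -/

/-- The norm of a ball average of a function bounded by `K` on the ball is at most `K` (`r > 0`). [folklore] -/
theorem norm_setAverage_ball_le {F : Type*} [NormedAddCommGroup F] [NormedSpace ℝ F] (hr : 0 < r) {g : E8 → F} {K : ℝ}
    (h : ∀ w ∈ ball (0 : E8) r, ‖g w‖ ≤ K) : ‖⨍ w in ball (0 : E8) r, g w‖ ≤ K := by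
  have hvol : 0 < (volume : Measure E8).real (ball 0 r) :=
    ENNReal.toReal_pos (measure_ball_pos volume (0 : E8) hr).ne' measure_ball_lt_top.ne
  rw [setAverage_eq, norm_smul, norm_inv, Real.norm_of_nonneg hvol.le]
  have h1 : ‖∫ w in ball (0 : E8) r, g w‖ ≤ K * (volume : Measure E8).real (ball 0 r) :=
    norm_setIntegral_le_of_norm_le_const measure_ball_lt_top h
  calc ((volume : Measure E8).real (ball 0 r))⁻¹ * ‖∫ w in ball (0 : E8) r, g w‖
      ≤ ((volume : Measure E8).real (ball 0 r))⁻¹ * (K * (volume : Measure E8).real (ball 0 r)) :=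
        mul_le_mul_of_nonneg_left h1 (by positivity)
    _ = K := by field_simp

/-- Uniform bound: `‖smearedField r z‖ ≤ (vol B_r)⁻¹ · 3r`. [folklore] -/
theorem norm_smearedField_le_const (hr : 0 ≤ r) (z : E8) :
    ‖smearedField r z‖ ≤ ((volume : Measure E8).real (ball 0 r))⁻¹ * (3 * r) := by
  rw [smearedField, setAverage_eq, norm_smul, norm_inv, Real.norm_of_nonneg (by positivity)]
  exact mul_le_mul_of_nonneg_left (norm_setIntegral_pointField_sub_le z 0 hr) (inv_nonneg.2 measureReal_nonneg)

/-- Far bound: `‖smearedField r z‖ ≤ (3/π⁴) (‖z‖/2)⁻⁷` for `‖z‖ ≥ 2r` (`‖z - w‖ ≥ ‖z‖/2` on the ball). [folklore] -/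
theorem norm_smearedField_le_far (hr : 0 < r) {z : E8} (hz : 2 * r ≤ ‖z‖) :
    ‖smearedField r z‖ ≤ 3 / Real.pi ^ 4 * (‖z‖ / 2)⁻¹ ^ 7 := by
  refine norm_setAverage_ball_le hr fun w hw => ?_
  rw [mem_ball_zero_iff] at hw
  have h1 : ‖z‖ / 2 ≤ ‖z - w‖ := by have := norm_sub_norm_le z w; linarith
  rw [norm_pointField]
  exact mul_le_mul_of_nonneg_left (pow_le_pow_left₀ (by positivity) (inv_anti₀ (by linarith) h1) 7) (by positivity)

/-- Far weights: `(‖z‖/2)⁻¹ ≤ 2(1 + r⁻¹)(1 + ‖z‖)⁻¹` for `‖z‖ ≥ 2r > 0`. [folklore] -/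
theorem inv_half_norm_le_weight (hr : 0 < r) {z : E8} (hz : 2 * r ≤ ‖z‖) :
    (‖z‖ / 2)⁻¹ ≤ 2 * (1 + r⁻¹) * (1 + ‖z‖)⁻¹ := by
  have hz0 : 0 < ‖z‖ := by linarith
  have hs : 0 < ‖z‖ / 2 := by positivity
  have h4 : (‖z‖ / 2)⁻¹ ≤ (1 + r⁻¹) * (1 + ‖z‖ / 2)⁻¹ :=
    inv_le_mul_inv_one_add hs (by rw [inv_mul_eq_div, one_le_div hr]; linarith)
  have h5 : (1 + ‖z‖ / 2)⁻¹ ≤ 2 * (1 + ‖z‖)⁻¹ := by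
    rw [inv_eq_one_div, inv_eq_one_div, mul_one_div, div_le_div_iff₀ (by positivity) (by positivity)]
    nlinarith [norm_nonneg z]
  calc (‖z‖ / 2)⁻¹ ≤ (1 + r⁻¹) * (1 + ‖z‖ / 2)⁻¹ := h4
    _ ≤ (1 + r⁻¹) * (2 * (1 + ‖z‖)⁻¹) := mul_le_mul_of_nonneg_left h5 (by positivity)
    _ = 2 * (1 + r⁻¹) * (1 + ‖z‖)⁻¹ := by ring

/-- Near weights: `1 ≤ (1 + 2r)ᵏ (1 + ‖z‖)⁻ᵏ` for `‖z‖ < 2r`. [folklore] -/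
theorem one_le_weight_of_norm_lt {z : E8} (hz : ‖z‖ < 2 * r) (k : ℕ) :
    (1 : ℝ) ≤ (1 + 2 * r) ^ k * (1 + ‖z‖)⁻¹ ^ k := by
  rw [← mul_pow, inv_eq_one_div, mul_one_div]
  exact one_le_pow₀ ((one_le_div (by positivity)).2 (by linarith))

/-- **Weighted bound**: `‖smearedField r z‖ ≤ C (1 + ‖z‖)⁻⁷` for some `C ≥ 0` (`r > 0`). [folklore] -/
theorem exists_norm_smearedField_le_weight (hr : 0 < r) :
    ∃ C : ℝ, 0 ≤ C ∧ ∀ z : E8, ‖smearedField r z‖ ≤ C * (1 + ‖z‖)⁻¹ ^ 7 := by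
  set V : ℝ := ((volume : Measure E8).real (ball 0 r))⁻¹ with hV
  refine ⟨max (V * (3 * r) * (1 + 2 * r) ^ 7) (3 / Real.pi ^ 4 * (2 * (1 + r⁻¹)) ^ 7), le_max_of_le_left (by positivity),
    fun z => ?_⟩
  rcases lt_or_ge ‖z‖ (2 * r) with hz | hz
  · calc ‖smearedField r z‖ ≤ V * (3 * r) * 1 := by rw [mul_one]; exact norm_smearedField_le_const hr.le z
      _ ≤ V * (3 * r) * ((1 + 2 * r) ^ 7 * (1 + ‖z‖)⁻¹ ^ 7) :=
          mul_le_mul_of_nonneg_left (one_le_weight_of_norm_lt hz 7) (by positivity)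
      _ = V * (3 * r) * (1 + 2 * r) ^ 7 * (1 + ‖z‖)⁻¹ ^ 7 := by ring
      _ ≤ _ := mul_le_mul_of_nonneg_right (le_max_left _ _) (by positivity)
  · have h2 : (‖z‖ / 2)⁻¹ ^ 7 ≤ (2 * (1 + r⁻¹)) ^ 7 * (1 + ‖z‖)⁻¹ ^ 7 := by
      rw [← mul_pow]; exact pow_le_pow_left₀ (by positivity) (inv_half_norm_le_weight hr hz) 7
    calc ‖smearedField r z‖ ≤ 3 / Real.pi ^ 4 * (‖z‖ / 2)⁻¹ ^ 7 := norm_smearedField_le_far hr hz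
      _ ≤ 3 / Real.pi ^ 4 * ((2 * (1 + r⁻¹)) ^ 7 * (1 + ‖z‖)⁻¹ ^ 7) := mul_le_mul_of_nonneg_left h2 (by positivity)
      _ = 3 / Real.pi ^ 4 * (2 * (1 + r⁻¹)) ^ 7 * (1 + ‖z‖)⁻¹ ^ 7 := by ring
      _ ≤ _ := mul_le_mul_of_nonneg_right (le_max_right _ _) (by positivity)

/-- Uniform bound: `|smearedPotential r z| ≤ (vol B_r)⁻¹ (3π⁴/2) r²`. [folklore] -/
theorem abs_smearedPotential_le_const (r : ℝ) (z : E8) :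
    |smearedPotential r z| ≤ ((volume : Measure E8).real (ball 0 r))⁻¹ * (3 / 2 * Real.pi ^ 4 * r ^ 2) := by
  rw [smearedPotential, setAverage_eq, smul_eq_mul, abs_mul, abs_of_nonneg (by positivity)]
  exact mul_le_mul_of_nonneg_left (ballPotential_le 0 z r) (by positivity)

/-- Far bound: `|smearedPotential r z| ≤ (‖z‖/2)⁻⁶` for `‖z‖ ≥ 2r`. [folklore] -/
theorem abs_smearedPotential_le_far (hr : 0 < r) {z : E8} (hz : 2 * r ≤ ‖z‖) :
    |smearedPotential r z| ≤ (‖z‖ / 2)⁻¹ ^ 6 := by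
  rw [← Real.norm_eq_abs]
  refine norm_setAverage_ball_le hr fun w hw => ?_
  rw [mem_ball_zero_iff] at hw
  have h1 : ‖z‖ / 2 ≤ ‖z - w‖ := by have := norm_sub_norm_le z w; linarith
  rw [Real.norm_eq_abs, abs_of_nonneg (by positivity)]
  exact pow_le_pow_left₀ (by positivity) (inv_anti₀ (by linarith) h1) 6

/-- **Weighted bound**: `|smearedPotential r z| ≤ C (1 + ‖z‖)⁻⁶` for some `C ≥ 0` (`r > 0`). [folklore] -/
theorem exists_abs_smearedPotential_le_weight (hr : 0 < r) :
    ∃ C : ℝ, 0 ≤ C ∧ ∀ z : E8, |smearedPotential r z| ≤ C * (1 + ‖z‖)⁻¹ ^ 6 := by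
  set V : ℝ := ((volume : Measure E8).real (ball 0 r))⁻¹ with hV
  refine ⟨max (V * (3 / 2 * Real.pi ^ 4 * r ^ 2) * (1 + 2 * r) ^ 6) ((2 * (1 + r⁻¹)) ^ 6), le_max_of_le_left (by positivity),
    fun z => ?_⟩
  rcases lt_or_ge ‖z‖ (2 * r) with hz | hz
  · calc |smearedPotential r z| ≤ V * (3 / 2 * Real.pi ^ 4 * r ^ 2) * 1 := by
          rw [mul_one]; exact abs_smearedPotential_le_const r z
      _ ≤ V * (3 / 2 * Real.pi ^ 4 * r ^ 2) * ((1 + 2 * r) ^ 6 * (1 + ‖z‖)⁻¹ ^ 6) :=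
          mul_le_mul_of_nonneg_left (one_le_weight_of_norm_lt hz 6) (by positivity)
      _ = V * (3 / 2 * Real.pi ^ 4 * r ^ 2) * (1 + 2 * r) ^ 6 * (1 + ‖z‖)⁻¹ ^ 6 := by ring
      _ ≤ _ := mul_le_mul_of_nonneg_right (le_max_left _ _) (by positivity)
  · have h2 : (‖z‖ / 2)⁻¹ ^ 6 ≤ (2 * (1 + r⁻¹)) ^ 6 * (1 + ‖z‖)⁻¹ ^ 6 := by
      rw [← mul_pow]; exact pow_le_pow_left₀ (by positivity) (inv_half_norm_le_weight hr hz) 6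
    calc |smearedPotential r z| ≤ (‖z‖ / 2)⁻¹ ^ 6 := abs_smearedPotential_le_far hr hz
      _ ≤ (2 * (1 + r⁻¹)) ^ 6 * (1 + ‖z‖)⁻¹ ^ 6 := h2
      _ ≤ _ := mul_le_mul_of_nonneg_right (le_max_right _ _) (by positivity)

/-! ### The weak Gauss law -/

/-- Bounds of a test function and of its gradient. [folklore] -/
theorem exists_bounds_of_test {φ : E8 → ℝ} (hφ : ContDiff ℝ 1 φ) (hφc : HasCompactSupport φ) :
    ∃ K : ℝ, 0 ≤ K ∧ (∀ z, |φ z| ≤ K) ∧ ∀ z, ‖gradient φ z‖ ≤ K := by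
  obtain ⟨K₁, hK₁⟩ := hφc.exists_bound_of_continuous hφ.continuous
  have hgc : HasCompactSupport (gradient φ) :=
    (hφc.fderiv (𝕜 := ℝ)).comp_left (g := fun L : E8 →L[ℝ] ℝ => (InnerProductSpace.toDual ℝ E8).symm L) (map_zero _)
  obtain ⟨K₂, hK₂⟩ := hgc.exists_bound_of_continuous (Literature.Analysis.FluidPDE.continuous_gradient_of_contDiff hφ)
  refine ⟨max (max K₁ K₂) 0, le_max_right _ _, fun z => ?_, fun z => ?_⟩
  · rw [← Real.norm_eq_abs]; exact (hK₁ z).trans ((le_max_left _ _).trans (le_max_left _ _))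
  · exact (hK₂ z).trans ((le_max_right _ _).trans (le_max_left _ _))

/-- **Fubini for the regularised Laplacian**: `∫ Δv_t φ = ∫ ρ(w) (∫ Δf_t(z - w) φ(z) dz) dw`, `v_t = farPotential t ρ`.
[cite: LiebLoss2001, Thm 6.21] -/
theorem integral_laplacian_farPotential_mul_test {t : ℝ} (ht : 0 < t) (r : ℝ) {φ : E8 → ℝ} (hφ : ContDiff ℝ 1 φ)
    (hφc : HasCompactSupport φ) :
    ∫ z, (Δ (farPotential t (ballDensity r))) z * φ z =
      ∫ w, ballDensity r w * ∫ z, (Δ (newtonFar8 t)) (z - w) * φ z := by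
  obtain ⟨K, hK0, hKφ, -⟩ := exists_bounds_of_test hφ hφc
  obtain ⟨Rφ, hRφ⟩ := hφc.isCompact.isBounded.subset_closedBall (0 : E8)
  set Lf : E8 → ℝ := Δ (newtonFar8 t) with hLf
  have hLfc : Continuous Lf := continuous_laplacian_newtonFar8 ht
  obtain ⟨KL, hKL⟩ := (hasCompactSupport_laplacian_newtonFar8 ht).exists_bound_of_continuous hLfc
  have hρi := integrable_ballDensity r
  have hρ0 : ∀ w : E8, r < ‖w‖ → ballDensity r w = 0 := fun w hw => ballDensity_eq_zero hw
  -- the product integrand `(z, w) ↦ ρ(w) (Δf_t(z - w) φ(z))`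
  have hH : Integrable (uncurry fun z w => ballDensity r w * (Lf (z - w) * φ z)) (volume.prod volume) := by
    refine integrable_prod_of_bdd_support ?_ (K := ((volume : Measure E8).real (ball 0 r))⁻¹ * (KL * K))
      (a := Rφ) (b := |r|) (fun p => ?_) (fun p hp => ?_)
    · exact (hρi.aestronglyMeasurable.comp_snd).mul
        (((hLfc.comp (continuous_fst.sub continuous_snd)).aestronglyMeasurable).mul
          (hφ.continuous.comp continuous_fst).aestronglyMeasurable)
    · simp only [uncurry]
      rw [abs_mul, abs_mul]
      exact mul_le_mul (abs_ballDensity_le r _) (mul_le_mul ((Real.norm_eq_abs _).symm.le.trans (hKL _)) (hKφ _)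
        (abs_nonneg _) ((norm_nonneg _).trans (hKL 0))) (by positivity) (by positivity)
    · simp only [uncurry] at hp
      have hρw : ballDensity r p.2 ≠ 0 := fun h => hp (by rw [h, zero_mul])
      have hφz : φ p.1 ≠ 0 := fun h => hp (by rw [h, mul_zero, mul_zero])
      refine ⟨hRφ (subset_tsupport _ hφz), mem_closedBall_zero_iff.2 ?_⟩
      by_contra h
      exact hρw (hρ0 _ (lt_of_le_of_lt (le_abs_self r) (not_le.1 h)))
  have hstep1 : ∫ z, (Δ (farPotential t (ballDensity r))) z * φ z = ∫ z, ∫ w, ballDensity r w * (Lf (z - w) * φ z) := by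
    refine integral_congr_ae (Eventually.of_forall fun z => ?_)
    simp only
    rw [laplacian_farPotential ht hρi hρ0 z, ← integral_mul_const]
    exact integral_congr_ae (Eventually.of_forall fun w => by simp only; ring)
  rw [hstep1, integral_integral_swap hH]
  refine integral_congr_ae (Eventually.of_forall fun w => ?_)
  simp only
  rw [← integral_const_mul]

/-- **THE WEAK GAUSS LAW for the smeared field**: `∫ ⟪smearedField r z, ∇φ(z)⟫ dz = -⨍_{B(0,r)} φ` for every
`φ ∈ C¹_c(ℝ⁸)` (`r > 0`). [cite: LiebLoss2001, Thm 9.7] -/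
theorem integral_inner_smearedField_gradient (hr : 0 < r) {φ : E8 → ℝ} (hφ : ContDiff ℝ 1 φ) (hφc : HasCompactSupport φ) :
    ∫ z, ⟪smearedField r z, gradient φ z⟫ = -⨍ z in ball (0 : E8) r, φ z := by
  obtain ⟨A, hA0, hA⟩ := exists_norm_fderiv_newtonFar8_le_uniform
  obtain ⟨K, hK0, hKφ, hKg⟩ := exists_bounds_of_test hφ hφc
  set τ : ℕ → ℝ := fun n => 1 / ((n : ℝ) + 1) with hτ
  have hτpos : ∀ n, 0 < τ n := fun n => by rw [hτ]; positivity
  have hτle : ∀ n, τ n ≤ 1 := fun n => by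
    rw [hτ]; simp only; rw [div_le_one (by positivity)]; linarith [n.cast_nonneg (α := ℝ)]
  have hτlim : Tendsto τ atTop (𝓝 0) := tendsto_one_div_add_atTop_nhds_zero_nat
  have hρi := integrable_ballDensity r
  have hρ0 : ∀ w : E8, r < ‖w‖ → ballDensity r w = 0 := fun w hw => ballDensity_eq_zero hw
  set v : ℕ → E8 → ℝ := fun n => farPotential (τ n) (ballDensity r) with hv
  set G : E8 → E8 := fun z => -(2 * Real.pi ^ 4) • smearedField r z with hG
  -- Green for each `n`
  have hI : ∀ n, ∫ z, ⟪gradient (v n) z, gradient φ z⟫ = -∫ z, (Δ (v n)) z * φ z := fun n =>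
    integral_inner_gradient_gradient_eq (contDiff_farPotential (hτpos n) hρi hρ0 2) hφ hφc
  -- the gradients converge to `G`, uniformly
  set C : ℝ := ((volume : Measure E8).real (ball 0 r))⁻¹ * (A + 6) * (2 * Real.pi ^ 4) with hC
  have hC0 : 0 ≤ C := by positivity
  have hest : ∀ n z, ‖gradient (v n) z - G z‖ ≤ C * τ n := fun n z => by
    have h := norm_gradient_farPotential_add_smearedField_le hA0 hA (hτpos n) r z
    rw [hG]; simp only [neg_smul, sub_neg_eq_add]
    calc _ ≤ _ := h
      _ = C * τ n := by rw [hC]; ring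
  -- the left-hand sides converge
  set B : ℝ := 2 * Real.pi ^ 4 * (((volume : Measure E8).real (ball 0 r))⁻¹ * (3 * r)) with hB
  have hGb : ∀ z, ‖G z‖ ≤ B := fun z => by
    rw [hG]; simp only
    rw [norm_smul, norm_neg, Real.norm_of_nonneg (by positivity), hB]
    exact mul_le_mul_of_nonneg_left (norm_smearedField_le_const hr.le z) (by positivity)
  have hL : Tendsto (fun n => ∫ z, ⟪gradient (v n) z, gradient φ z⟫) atTop (𝓝 (∫ z, ⟪G z, gradient φ z⟫)) := by
    have hgc : Continuous (gradient φ) := Literature.Analysis.FluidPDE.continuous_gradient_of_contDiff hφ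
    have hgcs : HasCompactSupport (gradient φ) :=
      (hφc.fderiv (𝕜 := ℝ)).comp_left (g := fun L : E8 →L[ℝ] ℝ => (InnerProductSpace.toDual ℝ E8).symm L) (map_zero _)
    refine tendsto_integral_of_dominated_convergence (fun z => (B + C) * ‖gradient φ z‖) (fun n => ?_) ?_ (fun n => ?_) ?_
    · exact ((Literature.Analysis.FluidPDE.continuous_gradient_of_contDiff
        (contDiff_farPotential (hτpos n) hρi hρ0 1)).inner hgc).aestronglyMeasurable
    · exact (hgc.norm.integrable_of_hasCompactSupport hgcs.norm).const_mul _
    · refine Eventually.of_forall fun z => ?_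
      rw [Real.norm_eq_abs]
      refine (abs_real_inner_le_norm _ _).trans (mul_le_mul_of_nonneg_right ?_ (norm_nonneg _))
      have h1 : ‖gradient (v n) z‖ ≤ ‖G z‖ + ‖gradient (v n) z - G z‖ := by
        have := norm_add_le (G z) (gradient (v n) z - G z); rwa [add_sub_cancel] at this
      have h2 : C * τ n ≤ C := by nlinarith [hτle n, hτpos n]
      linarith [hGb z, hest n z]
    · refine Eventually.of_forall fun z => Tendsto.inner ?_ tendsto_const_nhds
      refine tendsto_iff_norm_sub_tendsto_zero.2 (squeeze_zero (fun n => norm_nonneg _) (fun n => hest n z) ?_)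
      simpa using hτlim.const_mul C
  -- the right-hand sides converge
  have hR : Tendsto (fun n => ∫ z, (Δ (v n)) z * φ z) atTop (𝓝 (∫ w, ballDensity r w * (-(2 * Real.pi ^ 4) * φ w))) := by
    have hfub : ∀ n, ∫ z, (Δ (v n)) z * φ z = ∫ w, ballDensity r w * ∫ z, (Δ (newtonFar8 (τ n))) (z - w) * φ z :=
      fun n => integral_laplacian_farPotential_mul_test (hτpos n) r hφ hφc
    simp_rw [hfub]
    refine tendsto_integral_of_dominated_convergence (fun w => |ballDensity r w| * (K * ∫ u, |(Δ (newtonFar8 1)) u|))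
      (fun n => ?_) (hρi.abs.mul_const _) (fun n => Eventually.of_forall fun w => ?_) ?_
    · have hk : Integrable fun y : E8 => (Δ (newtonFar8 (τ n))) (-y) := (integrable_laplacian_newtonFar8 (hτpos n)).comp_neg
      have hk0 : ∀ y : E8, 2 * τ n < ‖y‖ → (Δ (newtonFar8 (τ n))) (-y) = 0 := fun y hy =>
        laplacian_newtonFar8_eq_zero_of_le (hτpos n) (by rw [norm_neg]; exact hy.le)
      have hcont := Literature.Analysis.FluidPDE.continuous_integral_smul_comp_sub hk hk0 hφ.continuous
      have heq : (fun w : E8 => ∫ z, (Δ (newtonFar8 (τ n))) (z - w) * φ z) =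
          fun w => ∫ y, (Δ (newtonFar8 (τ n))) (-y) • φ (w - y) := by
        funext w
        have h := integral_neg_eq_self (fun y : E8 => (Δ (newtonFar8 (τ n))) (-y) * φ (w - y)) volume
        have h2 := integral_add_right_eq_self (μ := (volume : Measure E8)) (fun z => (Δ (newtonFar8 (τ n))) (z - w) * φ z) w
        simp only [neg_neg, sub_neg_eq_add, add_sub_cancel_right] at h h2
        simp only [smul_eq_mul]
        rw [← h2, ← h]
        exact integral_congr_ae (Eventually.of_forall fun y => by simp only [add_comm])
      rw [← heq] at hcont
      exact hρi.aestronglyMeasurable.mul hcont.aestronglyMeasurable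
    · rw [Real.norm_eq_abs, abs_mul]
      exact mul_le_mul_of_nonneg_left (abs_integral_laplacian_newtonFar8_sub_mul_le (hτpos n) hKφ w) (abs_nonneg _)
    · exact Eventually.of_forall fun w =>
        (tendsto_integral_laplacian_newtonFar8_mul hφ.continuous hKφ hτpos hτlim w).const_mul _
  -- identify the limits
  have hlim := tendsto_nhds_unique (hL.congr fun n => hI n) hR.neg
  have hRval : ∫ w, ballDensity r w * (-(2 * Real.pi ^ 4) * φ w) = -(2 * Real.pi ^ 4) * ⨍ w in ball (0 : E8) r, φ w := by
    rw [← integral_ballDensity_smul, ← integral_const_mul]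
    exact integral_congr_ae (Eventually.of_forall fun w => by simp only [smul_eq_mul]; ring)
  have hLval : ∫ z, ⟪G z, gradient φ z⟫ = -(2 * Real.pi ^ 4) * ∫ z, ⟪smearedField r z, gradient φ z⟫ := by
    rw [← integral_const_mul]
    exact integral_congr_ae (Eventually.of_forall fun z => by rw [hG]; simp only; rw [inner_smul_left, RCLike.conj_to_real])
  rw [hRval, hLval] at hlim
  have hπ : -(2 * Real.pi ^ 4) ≠ 0 := neg_ne_zero.2 (by positivity)
  have h2 : -(2 * Real.pi ^ 4) * ∫ z, ⟪smearedField r z, gradient φ z⟫ =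
      -(2 * Real.pi ^ 4) * -⨍ w in ball (0 : E8) r, φ w := by
    rw [hlim]; ring
  exact mul_left_cancel₀ hπ h2

/-- **Registered sub-goal `fccMirror_smearedField_weakDiv`** (line `flux-cell-joint-census`, support of
`stub_fccMirrorExact`): the weak Gauss law of the smeared Newton field of the uniform 8-ball, binder form of
`integral_inner_smearedField_gradient`. [cite: LiebLoss2001, Thm 9.7] -/
theorem fccMirror_smearedField_weakDiv : ∀ (r : ℝ), 0 < r → ∀ φ : E8 → ℝ, ContDiff ℝ 1 φ → HasCompactSupport φ →
    ∫ z, inner ℝ (smearedField r z) (gradient φ z) = -⨍ z in Metric.ball (0 : E8) r, φ z :=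
  fun _ hr _ hφ hφc => integral_inner_smearedField_gradient hr hφ hφc

end Summit.AtomisticToContinuum.Crystallization.Theorems.PricedLinkCensusLocalToGlobal

end
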